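import Literature.Geometry.Riemannian.GurskyViaclovskyClosedness
import Literature.Geometry.Riemannian.GurskyViaclovskyOpennessProofs
import HarnessLib

/-!
# Gursky–Viaclovsky closedness: the limit step (admissibility of limits, the assembly from a
# `C²`-convergent family) and the reduction of the named fact to a compactness principle

Support file (everything PROVED; no definition, no named fact) for the named fact
`Literature.Geometry.Riemannian.gurskyViaclovsky_pathClosed_weighted_four`
(`GurskyViaclovskyClosedness.lean`; Gursky–Viaclovsky, J. Differential Geom. 63 (2003) 131–154,
arXiv:math/0301350, Prop. 6 and §5: the solvable set `𝒮` of the Weyl-weighted `σ₂` continuity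
path is closed). The printed closedness proof is "Proposition (C2estimate) then implies that `𝒮`
is closed" (§5), Prop. 6 being the `C^{2,α}` bound obtained from the `C²` bound through "Since
`f(x) > 0`, the `C²` estimate implies uniform ellipticity, and the `C^{2,α}` estimate then follows
from the work of [Krylov] and [Evans] on concave, uniformly elliptic equations". Unfolded, the
step has an ANALYTIC half — from a `C²`-bounded sequence of admissible solutions extract a
`C²`-convergent subsequence with a `C^∞` limit (Evans–Krylov `C^{2,α}` estimates, Arzelà–Ascoli,
Schauder regularity; absent from Mathlib and from the tree) — and an ALGEBRAIC half: the limit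
solves the limit equation and is still ADMISSIBLE (`A^t_u ∈ Γ₂⁺`, i.e. `R_h > 0` in the tree's
vocabulary), because `σ₂ ≥ c > 0` forbids `σ₁ = 0`. This file proves the algebraic half and the
assembly, in the vocabulary of `GurskyViaclovskyPath.lean` and of the background dictionary of
`GurskyViaclovskyOpennessProofs.lean` (`backgroundPathOperator g t w = e^{4w}·P_t(e^{2w}g)`,
`backgroundScalar g w = e^{2w}·R_{e^{2w}g}`, `solvable_of_background`):

* `pathOperator_eq_tracelessRicci` — **`P_t(h) = −½|E_h|² − ¼|W_h|² + (3−2t)² R_h²/24`**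
  (`σ₂(A) = −½|E|² + R²/24`, `sigma2WeylSchouten_eq`, and `1 + 4(1−t)(2−t) = (3−2t)²`); hence the
  intrinsic Maclaurin inequality `pathOperator_add_weylNormSq_le`:
  `P_t(h) + ¼|W_h|² ≤ (3−2t)²R_h²/24` — Gursky–Viaclovsky's `σ₂(A^t_u) ≤ (3/8)σ₁(A^t_u)²` read on
  the conformal metric (`4σ₂(h⁻¹A^t_h) = P_t(h) + ¼|W_h|²`, `σ₁(h⁻¹A^t_h) = (3−2t)R_h/6`);
* `scalarCurvature_pos_of_pathOperator_pos` — **admissibility of limits**: `R_h ≥ 0` and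
  `P_t(h) + ¼|W_h|² > 0` force `R_h > 0` (the cone step "`σ₁ = 0 ⇒ σ₂ = −½|A|² ≤ 0`");
  `IsPathSolution.mul_exp_le_sq_scalarCurvature` — along solutions `24 q e^{8u} ≤ (3−2t)²R_h²`, a
  uniform admissibility margin from `min q`, `sup|u|` and `t`;
* `backgroundPathOperator_add_weylNormSq_le`, `backgroundScalar_pos_of_pos` — the same on the
  background `g` (through `h = g.confSmul e^{2w}` and the dictionary);
* `solvable_of_background_limit` — **the assembly of the closedness step**: if smooth background
  solutions `w_k` at parameters `s_k` (`backgroundPathOperator g s_k w_k = q e^{−4w_k}`,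
  `backgroundScalar g w_k > 0`) converge pointwise, together with their background operators and
  background scalars, to a smooth `w` and its background quantities at parameter `t`, then
  `t ∈ 𝒮` (limit equation by uniqueness of limits, `backgroundScalar g w ≥ 0` as a limit, `> 0` by
  the cone step, `solvable_of_background`);
* `backgroundScalar_eq_frame`, `backgroundPathOperator_eq_frame` — the background quantities are
  POLYNOMIALS in the orthonormal-frame entries of `(Hess_g w, dw)` and `t` (the frame dictionary
  of `Sigma2ConformalFour.lean`; cf. `exp_mul_pathOperator_conformal_exp_frame` of
  `GurskyViaclovskyC2EstimateProofs.lean`), hence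
  `tendsto_backgroundPathOperator_of_frame`, `tendsto_backgroundScalar_of_frame`: they converge
  pointwise along any sequence `w_k → w` whose frame `2`-jets converge (`s_k → t`), and
  `solvable_of_frame_limit`: the assembly from frame-`C²` convergence;
* `pathClosed_of_backgroundCompactness`, `pathClosed_of_frameCompactness` — **the named fact
  follows from the compactness principle** "a `C²`-bounded sequence of smooth admissible
  background solutions at `s_k → t`, `s_k ≤ 1`, has a subsequence converging pointwise, with its
  background operators and scalars (first form) or with the frame entries of its covariant
  Hessians and differentials (second form), to a `C^∞` function" — stated INLINE as the
  hypothesis (it is exactly what Evans–Krylov + Arzelà–Ascoli + Schauder regularity deliver; it is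
  NOT proved here and is not vended as a fact);
* `tendsto_hessian_and_mvfderiv_of_chart`, `pathClosed_of_chartCompactness` (appended) — chart
  `C²` convergence at a point (first and second Fréchet derivatives of `u_k ∘ (chartAt x)⁻¹` at
  `chartAt x x`) gives the convergence of the covariant Hessians and differentials at `x`
  (O'Neill 1983, Lemma 3.49, through `OpensChart.hessian_eq` and the inverse-chart pullback
  `hessian_comap_apply`), hence the compactness principle may be stated through the chart
  representatives — the Euclidean form in which the elliptic theory would deliver it.

## References

* M. J. Gursky, J. A. Viaclovsky, *A fully nonlinear equation on four-manifolds with positive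
  scalar curvature*, J. Differential Geom. 63 (2003) 131–154, arXiv:math/0301350: §2 (Def. 1,
  Prop. 1), §3 (proof of Prop. 3: Newton–Maclaurin), §5 (Prop. 6, the set `𝒮`, proof of Thm. 1).
  [GurskyViaclovsky2003]
* S.-Y. A. Chang, M. J. Gursky, P. C. Yang, Publ. Math. IHÉS 98 (2003), §2, p. 121
  (`σ₂(A) = −½|E|² + R²/24`). [ChangGurskyYang2003]
* B. O'Neill, *Semi-Riemannian geometry* (1983), Ch. 3, Lemma 3.49 (the Hessian in
  coordinates). [ONeill1983]
-/

noncomputable section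

open scoped Manifold ContDiff Topology
open Set Filter Module

namespace Literature.Geometry.Riemannian.GurskyViaclovskyPath

open Literature.Geometry.Lorentzian (PseudoRiemannianMetric)
open Literature.Geometry.Lorentzian.PseudoRiemannianMetric

/-! ### The path operator through `|E|²`, `|W|²`, `R`; admissibility of limits -/

section Intrinsic

variable {M : Type*} [TopologicalSpace M] [ChartedSpace (EuclideanSpace ℝ (Fin 4)) M]
  [IsManifold (𝓡 4) ∞ M]
  (h : PseudoRiemannianMetric (𝓡 4) ∞ (EuclideanSpace ℝ (Fin 4)) (TangentSpace (𝓡 4) : M → Type _))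
  [h.HasLeviCivita]

/-- **`P_t(h) = −½|E_h|² − ¼|W_h|² + (3−2t)² R_h²/24`** for a Riemannian `C^∞` metric on a
`4`-manifold: `σ₂(A) = −½|E|² + R²/24` (Chang–Gursky–Yang 2003, §2, p. 121; tree:
`sigma2WeylSchouten_eq`) and `R²/24 + (1−t)(2−t)R²/6 = (3−2t)²R²/24`. In Gursky–Viaclovsky's
normalisation this is `4σ₂(h⁻¹A^t_h) = −½|E_h|² + (3/2)σ₁(h⁻¹A^t_h)²` with
`σ₁(h⁻¹A^t_h) = (3−2t)R_h/6` (proof of Prop. 4 and Lemma 3).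
[cite: GurskyViaclovsky2003, §5, proof of Lemma 3] [cite: ChangGurskyYang2003, §2, p. 121] -/
theorem pathOperator_eq_tracelessRicci (hh : h.IsRiemannian) (t : ℝ) (x : M) :
    pathOperator h t x = -(1 / 2) * h.tracelessRicciNormSq x - 1 / 4 * h.weylNormSq x
      + (3 - 2 * t) ^ 2 * h.scalarCurvature x ^ 2 / 24 := by
  have hE : finrank ℝ (EuclideanSpace ℝ (Fin 4)) = 4 := finrank_euclideanSpace_fin
  have hn : (2 : ℕ∞ω) ≤ ((⊤ : ℕ∞) : ℕ∞ω) := WithTop.coe_le_coe.mpr le_top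
  rw [pathOperator, h.sigma2WeylSchouten_eq hn hE (fun v hv ↦ hh x v hv)]
  ring

/-- **Maclaurin's inequality read on the conformal metric**: `P_t(h) + ¼|W_h|² ≤ (3−2t)²R_h²/24`
(i.e. `σ₂(h⁻¹A^t_h) ≤ (3/8)σ₁(h⁻¹A^t_h)²`; Gursky–Viaclovsky 2003, proof of Prop. 3: "From
Newton's inequality `(4/√6)σ₂^{1/2} ≤ σ₁`"). [cite: GurskyViaclovsky2003, §3, proof of Prop. 3] -/
theorem pathOperator_add_weylNormSq_le (hh : h.IsRiemannian) (t : ℝ) (x : M) :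
    pathOperator h t x + 1 / 4 * h.weylNormSq x ≤
      (3 - 2 * t) ^ 2 * h.scalarCurvature x ^ 2 / 24 := by
  rw [pathOperator_eq_tracelessRicci h hh t x]
  nlinarith [h.tracelessRicciNormSq_nonneg x]

/-- **Admissibility of limits** (the cone step of "Proposition (C2estimate) then implies that `𝒮`
is closed", Gursky–Viaclovsky 2003, §5): for a Riemannian `C^∞` metric `h` on a `4`-manifold, if
`R_h(x) ≥ 0` and `P_t(h)(x) + ¼|W_h|²(x) > 0` (e.g. `P_t(h) = q e^{8u} > 0`), then `R_h(x) > 0` —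
"`σ₁ = 0` gives `σ₂ = −½|A|² ≤ 0`". A pointwise limit of admissible (`R > 0`) solutions has `R ≥ 0`
and solves the limit equation, hence is admissible. [cite: GurskyViaclovsky2003, §5, proof of Thm. 1] -/
theorem scalarCurvature_pos_of_pathOperator_pos (hh : h.IsRiemannian) {t : ℝ} {x : M}
    (hP : 0 < pathOperator h t x + 1 / 4 * h.weylNormSq x) (hR : 0 ≤ h.scalarCurvature x) :
    0 < h.scalarCurvature x := by
  have hle := pathOperator_add_weylNormSq_le h hh t x
  rcases hR.eq_or_lt with h0 | h0
  · rw [← h0] at hle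
    nlinarith
  · exact h0

variable {h}
  {g : PseudoRiemannianMetric (𝓡 4) ∞ (EuclideanSpace ℝ (Fin 4)) (TangentSpace (𝓡 4) : M → Type _)}

/-- **A uniform admissibility margin along solutions**: for a path solution `h = e^{−2u} g` at
parameter `t` with right-hand side `q`, `24 q e^{8u} + 6|W_h|² ≤ (3−2t)² R_h²` pointwise; with
`q ≥ q₀ > 0`, `|u| ≤ C` and `t ≤ 1` this bounds `R_h` below by `(24 q₀)^{1/2} e^{−4C}/(3 − 2t)`
uniformly — the confinement of `g⁻¹A^t_{u}` to a compact part of `Γ₂⁺` used in "the `C²`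
estimate implies uniform ellipticity" (proof of Prop. 6). [cite: GurskyViaclovsky2003, §5, proof of Prop. 6] -/
theorem IsPathSolution.mul_exp_le_sq_scalarCurvature {u : M → ℝ} {t : ℝ} {q : M → ℝ}
    (hs : IsPathSolution g h u t q) (x : M) :
    24 * (q x * Real.exp (8 * u x)) + 6 * h.weylNormSq x ≤
      (3 - 2 * t) ^ 2 * h.scalarCurvature x ^ 2 := by
  have hle := pathOperator_add_weylNormSq_le h hs.isRiemannian t x
  rw [hs.pathOperator_eq x] at hle
  linarith

/-- For a path solution with `q(x) > 0` the scalar curvature does not vanish at `x` — so the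
admissibility clause `R_h > 0` of `IsPathSolution` is equivalent, given the equation, to `R_h ≥ 0`
("`σ₂ > 0` is forced by `q > 0`, so `σ₁ ≠ 0` pointwise"). [cite: GurskyViaclovsky2003, §5 (the set 𝒮) and Def. 1] -/
theorem IsPathSolution.scalarCurvature_ne_zero {u : M → ℝ} {t : ℝ} {q : M → ℝ}
    (hs : IsPathSolution g h u t q) {x : M} (hq : 0 < q x) : h.scalarCurvature x ≠ 0 := by
  intro h0
  have hle := hs.mul_exp_le_sq_scalarCurvature x
  rw [h0] at hle
  nlinarith [h.weylNormSq_nonneg x, mul_pos hq (Real.exp_pos (8 * u x))]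

end Intrinsic

/-! ### The same on the background metric -/

section Background

variable {M : Type*} [TopologicalSpace M] [ChartedSpace (EuclideanSpace ℝ (Fin 4)) M]
  [IsManifold (𝓡 4) ∞ M]
  (g : PseudoRiemannianMetric (𝓡 4) ∞ (EuclideanSpace ℝ (Fin 4)) (TangentSpace (𝓡 4) : M → Type _))
  [g.HasLeviCivita]

/-- **Maclaurin on the background**: for a Riemannian `C^∞` background `g` and `w ∈ C^∞`,
`backgroundPathOperator g t w + ¼|W_g|² ≤ (3−2t)²(backgroundScalar g w)²/24` pointwise — the
inequality `pathOperator_add_weylNormSq_le` for `h = e^{2w} g` (`g.confSmul`) multiplied by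
`e^{4w}`, through the dictionary `e^{4w}P_t(h) = backgroundPathOperator g t w`,
`e^{4w}|W_h|² = |W_g|²`, `e^{2w}R_h = backgroundScalar g w` of `GurskyViaclovskyOpennessProofs.lean`.
With `w = −u`: `4σ₂(g⁻¹A^t_u) ≤ (3/2)σ₁(g⁻¹A^t_u)²`. [cite: GurskyViaclovsky2003, §3, proof of Prop. 3] -/
theorem backgroundPathOperator_add_weylNormSq_le (hg : g.IsRiemannian) {w : M → ℝ}
    (hw : ContMDiff (𝓡 4) 𝓘(ℝ) ∞ w) (t : ℝ) (x : M) :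
    backgroundPathOperator g t w x + 1 / 4 * g.weylNormSq x ≤
      (3 - 2 * t) ^ 2 * backgroundScalar g w x ^ 2 / 24 := by
  have hexp : ContMDiff (𝓡 4) 𝓘(ℝ, ℝ) ∞ (fun y ↦ Real.exp (2 * w y)) :=
    Real.contDiff_exp.comp_contMDiff (contMDiff_const.mul hw)
  have hexp_pos : ∀ y : M, 0 < Real.exp (2 * w y) := fun y ↦ Real.exp_pos _
  set h := g.confSmul (fun y ↦ Real.exp (2 * w y)) hexp fun y ↦ (hexp_pos y).ne' with hh
  haveI : h.HasLeviCivita := h.hasLeviCivita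
  have hgh : ∀ (y : M) (v v' : TangentSpace (𝓡 4) y),
      h.val y v v' = Real.exp (2 * w y) * g.val y v v' := fun y v v' ↦ by
    rw [hh, confSmul_apply]
  have hhR : h.IsRiemannian := hg.confSmul hexp hexp_pos
  have key := exp_mul_pathOperator_eq_backgroundPathOperator g h hg hw hgh t x
  have hW := weylNormSq_eq_exp_neg_mul g h hg hw hgh x
  have hR := scalarCurvature_eq_backgroundScalar g h hw hgh x
  have hle := pathOperator_add_weylNormSq_le h hhR t x
  have h4 : 0 < Real.exp (4 * w x) := Real.exp_pos _
  have h4' : Real.exp (4 * w x) ≠ 0 := h4.ne'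
  have h2' : Real.exp (2 * w x) ≠ 0 := (Real.exp_pos _).ne'
  have hmul := mul_le_mul_of_nonneg_left hle h4.le
  have lhs : Real.exp (4 * w x) * (pathOperator h t x + 1 / 4 * h.weylNormSq x) =
      backgroundPathOperator g t w x + 1 / 4 * g.weylNormSq x := by
    rw [← key, hW, mul_add, mul_left_comm (Real.exp (4 * w x)) (1 / 4), mul_inv_cancel_left₀ h4']
  have h42 : Real.exp (4 * w x) = Real.exp (2 * w x) ^ 2 := by
    rw [← Real.exp_nat_mul]
    congr 1
    push_cast
    ring
  have hinv : Real.exp (2 * w x) ^ 2 * (Real.exp (2 * w x) ^ 2)⁻¹ = 1 :=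
    mul_inv_cancel₀ (pow_ne_zero 2 h2')
  have rhs : Real.exp (4 * w x) * ((3 - 2 * t) ^ 2 * h.scalarCurvature x ^ 2 / 24) =
      (3 - 2 * t) ^ 2 * backgroundScalar g w x ^ 2 / 24 := by
    rw [hR, h42]
    calc Real.exp (2 * w x) ^ 2 *
          ((3 - 2 * t) ^ 2 * ((Real.exp (2 * w x))⁻¹ * backgroundScalar g w x) ^ 2 / 24)
        = (Real.exp (2 * w x) ^ 2 * (Real.exp (2 * w x) ^ 2)⁻¹) *
            ((3 - 2 * t) ^ 2 * backgroundScalar g w x ^ 2 / 24) := by ring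
      _ = (3 - 2 * t) ^ 2 * backgroundScalar g w x ^ 2 / 24 := by rw [hinv, one_mul]
  rw [lhs, rhs] at hmul
  exact hmul

/-- **Admissibility of limits on the background**: for a Riemannian `C^∞` background `g` and
`w ∈ C^∞`, if `backgroundScalar g w x ≥ 0` and `backgroundPathOperator g t w x > 0` (e.g. the
background equation `= q e^{−4w}` with `q > 0` holds at `x`), then `backgroundScalar g w x > 0`
(`|W_g|² ≥ 0` and the Maclaurin inequality). [cite: GurskyViaclovsky2003, §5, proof of Thm. 1] -/
theorem backgroundScalar_pos_of_pos (hg : g.IsRiemannian) {w : M → ℝ}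
    (hw : ContMDiff (𝓡 4) 𝓘(ℝ) ∞ w) {t : ℝ} {x : M} (hP : 0 < backgroundPathOperator g t w x)
    (hS : 0 ≤ backgroundScalar g w x) : 0 < backgroundScalar g w x := by
  have hle := backgroundPathOperator_add_weylNormSq_le g hg hw t x
  have hWg := g.weylNormSq_nonneg x
  rcases hS.eq_or_lt with h0 | h0
  · rw [← h0] at hle
    nlinarith
  · exact h0

/-! ### The assembly of the closedness step from a convergent family -/

/-- **Closedness of `𝒮`, assembled from a convergent family of background solutions**
(Gursky–Viaclovsky 2003, §5: "Proposition (C2estimate) then implies that `𝒮` is closed", the part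
after the extraction of a convergent subsequence). On a Riemannian `C^∞` background `g` with a
right-hand side `q > 0`: let `w_k ∈ C^∞(M)` solve the background equations
`backgroundPathOperator g s_k w_k = q e^{−4w_k}` with `backgroundScalar g w_k > 0` (i.e.
`s_k ∈ 𝒮`, `solvable_iff_exists_background`), and let `w ∈ C^∞(M)` be such that, pointwise,
`w_k → w`, `backgroundPathOperator g s_k w_k → backgroundPathOperator g t w` and
`backgroundScalar g w_k → backgroundScalar g w` (all three are consequences of `C²` convergence
`w_k → w` and `s_k → t`). Then `t ∈ 𝒮`: the limit solves the background equation at `t`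
(uniqueness of limits), has `backgroundScalar g w ≥ 0` as a limit of positive functions, hence
`> 0` by `backgroundScalar_pos_of_pos`, and `solvable_of_background` applies.
[cite: GurskyViaclovsky2003, §5, proof of Thm. 1] -/
theorem solvable_of_background_limit (hg : g.IsRiemannian) {t : ℝ} {q : M → ℝ}
    (hq : ∀ x, 0 < q x) {s : ℕ → ℝ} {wk : ℕ → M → ℝ} {w : M → ℝ}
    (hw : ContMDiff (𝓡 4) 𝓘(ℝ) ∞ w)
    (heq : ∀ k x, backgroundPathOperator g (s k) (wk k) x = q x * Real.exp (-4 * wk k x))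
    (hpos : ∀ k x, 0 < backgroundScalar g (wk k) x)
    (hlimw : ∀ x, Tendsto (fun k ↦ wk k x) atTop (𝓝 (w x)))
    (hlimP : ∀ x, Tendsto (fun k ↦ backgroundPathOperator g (s k) (wk k) x) atTop
      (𝓝 (backgroundPathOperator g t w x)))
    (hlimS : ∀ x, Tendsto (fun k ↦ backgroundScalar g (wk k) x) atTop
      (𝓝 (backgroundScalar g w x))) :
    Solvable g t q := by
  have heq' : ∀ x, backgroundPathOperator g t w x = q x * Real.exp (-4 * w x) := fun x ↦ by
    have h1 : Tendsto (fun k ↦ q x * Real.exp (-4 * wk k x)) atTop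
        (𝓝 (q x * Real.exp (-4 * w x))) :=
      (((Real.continuous_exp.tendsto _).comp ((hlimw x).const_mul (-4))).const_mul (q x))
    have h2 : Tendsto (fun k ↦ q x * Real.exp (-4 * wk k x)) atTop
        (𝓝 (backgroundPathOperator g t w x)) := by
      have hfun : (fun k ↦ backgroundPathOperator g (s k) (wk k) x) =
          fun k ↦ q x * Real.exp (-4 * wk k x) := funext fun k ↦ heq k x
      rw [← hfun]
      exact hlimP x
    exact tendsto_nhds_unique h2 h1
  have hS0 : ∀ x, 0 ≤ backgroundScalar g w x := fun x ↦
    ge_of_tendsto' (hlimS x) fun k ↦ (hpos k x).le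
  have hS : ∀ x, 0 < backgroundScalar g w x := fun x ↦
    backgroundScalar_pos_of_pos g hg hw
      (by rw [heq' x]; exact mul_pos (hq x) (Real.exp_pos _)) (hS0 x)
  exact solvable_of_background g hg hw hS heq'

end Background

/-! ### Continuity of the background quantities in the frame `2`-jet -/

section FrameContinuity

variable {M : Type*} [TopologicalSpace M] [ChartedSpace (EuclideanSpace ℝ (Fin 4)) M]
  [IsManifold (𝓡 4) ∞ M]
  (g : PseudoRiemannianMetric (𝓡 4) ∞ (EuclideanSpace ℝ (Fin 4)) (TangentSpace (𝓡 4) : M → Type _))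
  [g.HasLeviCivita]

/-- `Δ_g w = Σ_a Hess_g w(e_a,e_a)` on a `g_x`-orthonormal frame (`Δ_g = tr_g Hess`,
`trace_eq_sum_of_isOrthonormalFrame`). [folklore] -/
theorem dalembertian_eq_sum_orthonormalFrame (w : M → ℝ) {x : M}
    {e : Fin 4 → TangentSpace (𝓡 4) x} (he : g.IsOrthonormalFrame x e) :
    g.dalembertian w x = ∑ a, g.hessian w x (e a) (e a) := by
  classical
  have hE : finrank ℝ (EuclideanSpace ℝ (Fin 4)) = 4 := finrank_euclideanSpace_fin
  have hι : Fintype.card (Fin 4) = finrank ℝ (EuclideanSpace ℝ (Fin 4)) := by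
    rw [Fintype.card_fin, hE]
  unfold PseudoRiemannianMetric.dalembertian
  rw [g.trace_eq_sum_of_isOrthonormalFrame (he.toBasis hι) (by rw [he.coe_toBasis hι]; exact he)]
  simp only [he.coe_toBasis hι]

omit [g.HasLeviCivita] in
/-- `|dw|²_g = Σ_a dw(e_a)²` on a `g_x`-orthonormal frame (`|dw|²_g = g⁻¹(dw,dw)`,
`innerDual_eq_sum_of_isOrthoᵢ`). [folklore] -/
theorem gradSq_eq_sum_orthonormalFrame (w : M → ℝ) {x : M}
    {e : Fin 4 → TangentSpace (𝓡 4) x} (he : g.IsOrthonormalFrame x e) :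
    g.gradSq w x = ∑ a, mvfderiv (𝓡 4) w x (e a) ^ 2 := by
  classical
  have hE : finrank ℝ (EuclideanSpace ℝ (Fin 4)) = 4 := finrank_euclideanSpace_fin
  have hι : Fintype.card (Fin 4) = finrank ℝ (EuclideanSpace ℝ (Fin 4)) := by
    rw [Fintype.card_fin, hE]
  have hO : (g.toBilinForm x).IsOrthoᵢ (he.toBasis hι) := by
    intro i j hij
    rw [he.coe_toBasis hι]
    exact he.2 i j hij
  have hcne : ∀ i, g.val x (he.toBasis hι i) (he.toBasis hι i) ≠ 0 := fun i ↦ by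
    rw [he.coe_toBasis hι, he.1 i]
    exact one_ne_zero
  rw [PseudoRiemannianMetric.gradSq, g.innerDual_eq_sum_of_isOrthoᵢ x (he.toBasis hι) hO hcne]
  refine Finset.sum_congr rfl fun a _ ↦ ?_
  rw [he.coe_toBasis hι, he.1 a, div_one, sq]
  rfl

/-- **`backgroundScalar` in a `g`-orthonormal frame**: `R_g − 6Σ_a Hess_g w(e_a,e_a) − 6Σ_a dw(e_a)²`.
[folklore] -/
theorem backgroundScalar_eq_frame (w : M → ℝ) {x : M}
    {e : Fin 4 → TangentSpace (𝓡 4) x} (he : g.IsOrthonormalFrame x e) :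
    backgroundScalar g w x = g.scalarCurvature x - 6 * ∑ a, g.hessian w x (e a) (e a)
      - 6 * ∑ a, mvfderiv (𝓡 4) w x (e a) ^ 2 := by
  rw [backgroundScalar, dalembertian_eq_sum_orthonormalFrame g w he,
    gradSq_eq_sum_orthonormalFrame g w he]

omit [g.HasLeviCivita] in
/-- **The covariant `C²` bounds bound the frame `2`-jets**: in a `g_x`-orthonormal frame every
entry of a bilinear form is bounded by its metric square norm, `T(e_a,e_b)² ≤ |T|²_g`
(`|T|²_g = Σ_{ij} T(e_j,e_i)²`, `normSq_eq_sum_sq`); with `T = Hess_g u` and `|∇²u|²_g ≤ C` this is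
the uniform bound `|Hess_g u(e_a,e_b)| ≤ √C` on the frame Hessians of the solutions in the
hypothesis of `gurskyViaclovsky_pathClosed_weighted_four` (the input of Arzelà–Ascoli). [folklore] -/
theorem sq_apply_frame_le_normSq {x : M} {e : Fin 4 → TangentSpace (𝓡 4) x}
    (he : g.IsOrthonormalFrame x e) (T : LinearMap.BilinForm ℝ (TangentSpace (𝓡 4) x))
    (a b : Fin 4) : T (e a) (e b) ^ 2 ≤ g.normSq x T := by
  classical
  have hE : finrank ℝ (EuclideanSpace ℝ (Fin 4)) = 4 := finrank_euclideanSpace_fin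
  have hι : Fintype.card (Fin 4) = finrank ℝ (EuclideanSpace ℝ (Fin 4)) := by
    rw [Fintype.card_fin, hE]
  have hO : (g.toBilinForm x).IsOrthoᵢ (he.toBasis hι) := by
    intro i j hij
    rw [he.coe_toBasis hι]
    exact he.2 i j hij
  have hcne : ∀ i, g.val x (he.toBasis hι i) (he.toBasis hι i) ≠ 0 := fun i ↦ by
    rw [he.coe_toBasis hι, he.1 i]
    exact one_ne_zero
  have hn := g.normSq_eq_sum_sq x (he.toBasis hι) hO hcne T
  simp only [he.coe_toBasis hι, he.1, mul_one, div_one] at hn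
  rw [hn]
  refine le_trans ?_ (Finset.single_le_sum (fun i _ ↦ Finset.sum_nonneg fun j _ ↦ sq_nonneg _)
    (Finset.mem_univ b))
  exact Finset.single_le_sum (fun j _ ↦ sq_nonneg (T (e j) (e b))) (Finset.mem_univ a)

omit [g.HasLeviCivita] in
/-- Likewise `dw(e_a)² ≤ |dw|²_g = g.gradSq w x` in a `g_x`-orthonormal frame (`|dw|²_g = Σ_a dw(e_a)²`):
with `|∇u|²_g ≤ C`, the uniform bound `|du(e_a)| ≤ √C` on the frame differentials. [folklore] -/
theorem sq_mvfderiv_frame_le_gradSq (w : M → ℝ) {x : M} {e : Fin 4 → TangentSpace (𝓡 4) x}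
    (he : g.IsOrthonormalFrame x e) (a : Fin 4) :
    mvfderiv (𝓡 4) w x (e a) ^ 2 ≤ g.gradSq w x := by
  rw [gradSq_eq_sum_orthonormalFrame g w he]
  exact Finset.single_le_sum (fun b _ ↦ sq_nonneg (mvfderiv (𝓡 4) w x (e b))) (Finset.mem_univ a)

/-- **`backgroundPathOperator` in a `g`-orthonormal frame** (the intrinsic quantities of its
definition read through the frame dictionary `trace_eq_sum_of_isOrthonormalFrame`,
`normSq_eq_sum_sq`, `sharp_eq_sum_of_isOrthoᵢ`, `innerBilin_eq_sum_mul`; the same expression as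
`exp_mul_pathOperator_conformal_exp_frame` of `GurskyViaclovskyC2EstimateProofs.lean`): with
`H_{ab} = Hess_g w(e_a,e_b)`, `b_a = dw(e_a)`, `Ric_{ab}`, `R = R_g(x)`,
`backgroundPathOperator g t w x = σ₂(A_g)(x) + [2ΣRic_{ab}H_{ab} − RΣH_{aa}] + 2[(ΣH_{aa})² − ΣH_{ab}²
− ΣRic_{ab}b_ab_b] + 2[(ΣH_{aa})(Σb_a²) + 2ΣH_{ab}b_ab_b] − ¼|W_g|²(x) + (1−t)(2−t)(R − 6ΣH_{aa} − 6Σb_a²)²/6`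
— a POLYNOMIAL in `(t, H, b)` with coefficients depending on `x` only (`w ∈ C²` near `x` suffices;
stated for `w ∈ C^∞`). [cite: GurskyViaclovsky2003, §1 (change1)–(PDE)] -/
theorem backgroundPathOperator_eq_frame {w : M → ℝ}
    (hw : ContMDiff (𝓡 4) 𝓘(ℝ) ∞ w) (t : ℝ) {x : M} {e : Fin 4 → TangentSpace (𝓡 4) x}
    (he : g.IsOrthonormalFrame x e) :
    backgroundPathOperator g t w x =
      g.sigma2WeylSchouten x
      + (2 * ∑ a, ∑ b, g.ricci x (e a) (e b) * g.hessian w x (e a) (e b)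
          - g.scalarCurvature x * ∑ a, g.hessian w x (e a) (e a))
      + 2 * ((∑ a, g.hessian w x (e a) (e a)) ^ 2 - ∑ a, ∑ b, g.hessian w x (e a) (e b) ^ 2
          - ∑ a, ∑ b, g.ricci x (e a) (e b) * (mvfderiv (𝓡 4) w x (e a) * mvfderiv (𝓡 4) w x (e b)))
      + 2 * ((∑ a, g.hessian w x (e a) (e a)) * (∑ a, mvfderiv (𝓡 4) w x (e a) ^ 2)
          + 2 * ∑ a, ∑ b, g.hessian w x (e a) (e b) *
              (mvfderiv (𝓡 4) w x (e a) * mvfderiv (𝓡 4) w x (e b)))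
      - 1 / 4 * g.weylNormSq x
      + (1 - t) * (2 - t) * (g.scalarCurvature x - 6 * ∑ a, g.hessian w x (e a) (e a)
          - 6 * ∑ a, mvfderiv (𝓡 4) w x (e a) ^ 2) ^ 2 / 6 := by
  classical
  have hE : finrank ℝ (EuclideanSpace ℝ (Fin 4)) = 4 := finrank_euclideanSpace_fin
  have hn2 : (2 : ℕ∞ω) ≤ ((⊤ : ℕ∞) : ℕ∞ω) := WithTop.coe_le_coe.mpr le_top
  have hι : Fintype.card (Fin 4) = finrank ℝ (EuclideanSpace ℝ (Fin 4)) := by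
    rw [Fintype.card_fin, hE]
  have hO : (g.toBilinForm x).IsOrthoᵢ (he.toBasis hι) := by
    intro i j hij
    rw [he.coe_toBasis hι]
    exact he.2 i j hij
  have hcne : ∀ i, g.val x (he.toBasis hι i) (he.toBasis hι i) ≠ 0 := fun i ↦ by
    rw [he.coe_toBasis hι, he.1 i]
    exact one_ne_zero
  unfold backgroundPathOperator
  -- the frame dictionary (as in `exp_mul_sigma2WeylSchouten_conformal_exp`)
  set dw := (mvfderiv (𝓡 4) w x).toLinearMap with hdw
  have h1 : g.dalembertian w x = ∑ a, g.hessian w x (e a) (e a) :=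
    dalembertian_eq_sum_orthonormalFrame g w he
  have h2 : g.normSq x (g.hessian w x) = ∑ a, ∑ b, g.hessian w x (e a) (e b) ^ 2 := by
    rw [g.normSq_eq_sum_sq x (he.toBasis hι) hO hcne, Finset.sum_comm]
    simp only [he.coe_toBasis hι, he.1, mul_one, div_one]
  have hsharp : g.sharp x dw = ∑ i, dw (e i) • e i := by
    rw [g.sharp_eq_sum_of_isOrthoᵢ x (he.toBasis hι) hO hcne]
    simp only [he.coe_toBasis hι, he.1, div_one]
  have hRsym : ∀ a b, g.ricci x (e a) (e b) = g.ricci x (e b) (e a) := fun a b ↦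
    (g.ricci_symm_holds hn2 x).eq (e a) (e b)
  have hw2 : ContMDiffAt (𝓡 4) 𝓘(ℝ, ℝ) 2 w x := (hw.of_le hn2).contMDiffAt
  have hHsym : ∀ a b, g.hessian w x (e a) (e b) = g.hessian w x (e b) (e a) := fun a b ↦
    (g.hessian_symm_holds hw2).eq (e a) (e b)
  have h3 : g.ricci x (g.sharp x dw) (g.sharp x dw) =
      ∑ a, ∑ b, g.ricci x (e a) (e b) * (dw (e a) * dw (e b)) := by
    rw [hsharp]
    simp only [map_sum, map_smul, LinearMap.sum_apply, LinearMap.smul_apply, smul_eq_mul,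
      Finset.mul_sum]
    refine Finset.sum_congr rfl fun a _ ↦ Finset.sum_congr rfl fun b _ ↦ ?_
    rw [hRsym b a]
    ring
  have h4 : g.hessian w x (g.sharp x dw) (g.sharp x dw) =
      ∑ a, ∑ b, g.hessian w x (e a) (e b) * (dw (e a) * dw (e b)) := by
    rw [hsharp]
    simp only [map_sum, map_smul, LinearMap.sum_apply, LinearMap.smul_apply, smul_eq_mul,
      Finset.mul_sum]
    refine Finset.sum_congr rfl fun a _ ↦ Finset.sum_congr rfl fun b _ ↦ ?_
    rw [hHsym b a]
    ring
  have h5 : g.gradSq w x = ∑ a, mvfderiv (𝓡 4) w x (e a) ^ 2 :=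
    gradSq_eq_sum_orthonormalFrame g w he
  have h6 : g.innerBilin x (g.ricci x) (g.hessian w x) =
      ∑ a, ∑ b, g.ricci x (e a) (e b) * g.hessian w x (e a) (e b) := by
    rw [g.innerBilin_eq_sum_mul x (he.toBasis hι) hO hcne, Finset.sum_comm]
    simp only [he.coe_toBasis hι, he.1, mul_one, div_one]
  have hdwe : ∀ a, dw (e a) = mvfderiv (𝓡 4) w x (e a) := fun a ↦ rfl
  simp only [hdwe] at h3 h4
  rw [h6, h1, h2, h3, h5, h4, backgroundScalar_eq_frame g w he]

/-- **The frame polynomial is continuous**: if `s_k → t` and the frame entries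
`H^k_{ab} → H_{ab}`, `b^k_a → b_a` converge, then the polynomial of `backgroundPathOperator_eq_frame`
converges (constants `σ, R, W, Ric_{ab}`). [folklore] -/
theorem tendsto_framePolynomial {s : ℕ → ℝ} {t : ℝ} (hs : Tendsto s atTop (𝓝 t))
    {Hk : ℕ → Fin 4 → Fin 4 → ℝ} {H : Fin 4 → Fin 4 → ℝ}
    (hH : ∀ a b, Tendsto (fun k ↦ Hk k a b) atTop (𝓝 (H a b)))
    {dk : ℕ → Fin 4 → ℝ} {d : Fin 4 → ℝ} (hd : ∀ a, Tendsto (fun k ↦ dk k a) atTop (𝓝 (d a)))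
    (σ R W : ℝ) (Rc : Fin 4 → Fin 4 → ℝ) :
    Tendsto (fun k ↦ σ
      + (2 * ∑ a, ∑ b, Rc a b * Hk k a b - R * ∑ a, Hk k a a)
      + 2 * ((∑ a, Hk k a a) ^ 2 - ∑ a, ∑ b, Hk k a b ^ 2 - ∑ a, ∑ b, Rc a b * (dk k a * dk k b))
      + 2 * ((∑ a, Hk k a a) * (∑ a, dk k a ^ 2) + 2 * ∑ a, ∑ b, Hk k a b * (dk k a * dk k b))
      - 1 / 4 * W
      + (1 - s k) * (2 - s k) * (R - 6 * ∑ a, Hk k a a - 6 * ∑ a, dk k a ^ 2) ^ 2 / 6) atTop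
    (𝓝 (σ
      + (2 * ∑ a, ∑ b, Rc a b * H a b - R * ∑ a, H a a)
      + 2 * ((∑ a, H a a) ^ 2 - ∑ a, ∑ b, H a b ^ 2 - ∑ a, ∑ b, Rc a b * (d a * d b))
      + 2 * ((∑ a, H a a) * (∑ a, d a ^ 2) + 2 * ∑ a, ∑ b, H a b * (d a * d b))
      - 1 / 4 * W
      + (1 - t) * (2 - t) * (R - 6 * ∑ a, H a a - 6 * ∑ a, d a ^ 2) ^ 2 / 6)) := by
  have hSH : Tendsto (fun k ↦ ∑ a, Hk k a a) atTop (𝓝 (∑ a, H a a)) :=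
    tendsto_finsetSum _ fun a _ ↦ hH a a
  have hSH2 : Tendsto (fun k ↦ ∑ a, ∑ b, Hk k a b ^ 2) atTop (𝓝 (∑ a, ∑ b, H a b ^ 2)) :=
    tendsto_finsetSum _ fun a _ ↦ tendsto_finsetSum _ fun b _ ↦ (hH a b).pow 2
  have hSRH : Tendsto (fun k ↦ ∑ a, ∑ b, Rc a b * Hk k a b) atTop (𝓝 (∑ a, ∑ b, Rc a b * H a b)) :=
    tendsto_finsetSum _ fun a _ ↦ tendsto_finsetSum _ fun b _ ↦ tendsto_const_nhds.mul (hH a b)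
  have hSRdd : Tendsto (fun k ↦ ∑ a, ∑ b, Rc a b * (dk k a * dk k b)) atTop
      (𝓝 (∑ a, ∑ b, Rc a b * (d a * d b))) :=
    tendsto_finsetSum _ fun a _ ↦ tendsto_finsetSum _ fun b _ ↦
      tendsto_const_nhds.mul ((hd a).mul (hd b))
  have hSd2 : Tendsto (fun k ↦ ∑ a, dk k a ^ 2) atTop (𝓝 (∑ a, d a ^ 2)) :=
    tendsto_finsetSum _ fun a _ ↦ (hd a).pow 2
  have hSHdd : Tendsto (fun k ↦ ∑ a, ∑ b, Hk k a b * (dk k a * dk k b)) atTop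
      (𝓝 (∑ a, ∑ b, H a b * (d a * d b))) :=
    tendsto_finsetSum _ fun a _ ↦ tendsto_finsetSum _ fun b _ ↦ (hH a b).mul ((hd a).mul (hd b))
  have hst : Tendsto (fun k ↦ (1 - s k) * (2 - s k)) atTop (𝓝 ((1 - t) * (2 - t))) :=
    (tendsto_const_nhds.sub hs).mul (tendsto_const_nhds.sub hs)
  exact ((((tendsto_const_nhds.add ((hSRH.const_mul 2).sub (hSH.const_mul R))).add
    ((((hSH.pow 2).sub hSH2).sub hSRdd).const_mul 2)).add
    (((hSH.mul hSd2).add (hSHdd.const_mul 2)).const_mul 2)).sub tendsto_const_nhds).add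
    ((hst.mul (((tendsto_const_nhds.sub (hSH.const_mul 6)).sub (hSd2.const_mul 6)).pow 2)).div_const 6)

/-- **Pointwise convergence of the background operators from convergence of the frame `2`-jets.**
If `s_k → t` and, at a point `x` with a `g_x`-orthonormal frame `e`, the frame entries of the
covariant Hessians and differentials of `w_k ∈ C^∞` converge to those of `w ∈ C^∞`, then
`backgroundPathOperator g s_k w_k (x) → backgroundPathOperator g t w (x)` (this is how the
hypotheses of `solvable_of_background_limit` follow from `C²` convergence `w_k → w`).
[cite: GurskyViaclovsky2003, §5, proof of Thm. 1] -/
theorem tendsto_backgroundPathOperator_of_frame {wk : ℕ → M → ℝ}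
    {w : M → ℝ} (hwk : ∀ k, ContMDiff (𝓡 4) 𝓘(ℝ) ∞ (wk k)) (hw : ContMDiff (𝓡 4) 𝓘(ℝ) ∞ w)
    {s : ℕ → ℝ} {t : ℝ} (hs : Tendsto s atTop (𝓝 t)) {x : M}
    {e : Fin 4 → TangentSpace (𝓡 4) x} (he : g.IsOrthonormalFrame x e)
    (hH : ∀ a b, Tendsto (fun k ↦ g.hessian (wk k) x (e a) (e b)) atTop
      (𝓝 (g.hessian w x (e a) (e b))))
    (hd : ∀ a, Tendsto (fun k ↦ mvfderiv (𝓡 4) (wk k) x (e a)) atTop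
      (𝓝 (mvfderiv (𝓡 4) w x (e a)))) :
    Tendsto (fun k ↦ backgroundPathOperator g (s k) (wk k) x) atTop
      (𝓝 (backgroundPathOperator g t w x)) := by
  rw [backgroundPathOperator_eq_frame g hw t he]
  refine Tendsto.congr (fun k ↦ (backgroundPathOperator_eq_frame g (hwk k) (s k) he).symm) ?_
  exact tendsto_framePolynomial hs hH hd _ _ _ _

/-- **Pointwise convergence of the background scalars from convergence of the frame `2`-jets**
(`backgroundScalar = R − 6ΣH_{aa} − 6Σb_a²` on the frame). [folklore] -/
theorem tendsto_backgroundScalar_of_frame {wk : ℕ → M → ℝ} {w : M → ℝ}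
    {x : M} {e : Fin 4 → TangentSpace (𝓡 4) x} (he : g.IsOrthonormalFrame x e)
    (hH : ∀ a b, Tendsto (fun k ↦ g.hessian (wk k) x (e a) (e b)) atTop
      (𝓝 (g.hessian w x (e a) (e b))))
    (hd : ∀ a, Tendsto (fun k ↦ mvfderiv (𝓡 4) (wk k) x (e a)) atTop
      (𝓝 (mvfderiv (𝓡 4) w x (e a)))) :
    Tendsto (fun k ↦ backgroundScalar g (wk k) x) atTop (𝓝 (backgroundScalar g w x)) := by
  rw [backgroundScalar_eq_frame g w he]
  refine Tendsto.congr (fun k ↦ (backgroundScalar_eq_frame g (wk k) he).symm) ?_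
  exact (tendsto_const_nhds.sub ((tendsto_finsetSum _ fun a _ ↦ hH a a).const_mul 6)).sub
    ((tendsto_finsetSum _ fun a _ ↦ (hd a).pow 2).const_mul 6)

/-- **Closedness of `𝒮`, assembled from frame-`C²` convergence** (the previous three results
chained with `solvable_of_background_limit`): smooth admissible background solutions `w_k` at
`s_k → t` with right-hand side `q > 0`, converging pointwise to a smooth `w` together with the
orthonormal-frame entries of their covariant Hessians and differentials at every point, give
`t ∈ 𝒮`. [cite: GurskyViaclovsky2003, §5, proof of Thm. 1] -/
theorem solvable_of_frame_limit (hg : g.IsRiemannian) {t : ℝ} {q : M → ℝ} (hq : ∀ x, 0 < q x)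
    {s : ℕ → ℝ} (hs : Tendsto s atTop (𝓝 t)) {wk : ℕ → M → ℝ} {w : M → ℝ}
    (hwk : ∀ k, ContMDiff (𝓡 4) 𝓘(ℝ) ∞ (wk k)) (hw : ContMDiff (𝓡 4) 𝓘(ℝ) ∞ w)
    (heq : ∀ k x, backgroundPathOperator g (s k) (wk k) x = q x * Real.exp (-4 * wk k x))
    (hpos : ∀ k x, 0 < backgroundScalar g (wk k) x)
    (hlimw : ∀ x, Tendsto (fun k ↦ wk k x) atTop (𝓝 (w x)))
    (hjet : ∀ (x : M) (e : Fin 4 → TangentSpace (𝓡 4) x), g.IsOrthonormalFrame x e →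
      (∀ a b, Tendsto (fun k ↦ g.hessian (wk k) x (e a) (e b)) atTop
        (𝓝 (g.hessian w x (e a) (e b)))) ∧
      (∀ a, Tendsto (fun k ↦ mvfderiv (𝓡 4) (wk k) x (e a)) atTop
        (𝓝 (mvfderiv (𝓡 4) w x (e a))))) :
    Solvable g t q := by
  have hE : finrank ℝ (EuclideanSpace ℝ (Fin 4)) = 4 := finrank_euclideanSpace_fin
  refine solvable_of_background_limit g hg hq hw heq hpos hlimw (fun x ↦ ?_) (fun x ↦ ?_)
  · obtain ⟨e, he⟩ := g.exists_basis_isOrthonormalFrame (x := x) (fun v hv ↦ hg x v hv) hE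
    exact tendsto_backgroundPathOperator_of_frame g hwk hw hs he (hjet x e he).1 (hjet x e he).2
  · obtain ⟨e, he⟩ := g.exists_basis_isOrthonormalFrame (x := x) (fun v hv ↦ hg x v hv) hE
    exact tendsto_backgroundScalar_of_frame g he (hjet x e he).1 (hjet x e he).2

end FrameContinuity

/-! ### The named fact from the compactness principle -/

section Reduction

/-- **`gurskyViaclovsky_pathClosed_weighted_four` follows from the `C²`-compactness principle for
the background equation** — the analytic half of Gursky–Viaclovsky's closedness step, stated here
INLINE as the hypothesis `hcore` and NOT proved in the tree: on a compact connected `M⁴` with a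
Riemannian `C^∞` background `g` and `C^∞` right-hand side `q > 0`, every sequence
`u_k ∈ C^∞(M)` of admissible background solutions at parameters `s_k → t`, `s_k ≤ 1`
(`backgroundPathOperator g s_k (−u_k) = q e^{4u_k}`, `backgroundScalar g (−u_k) > 0`) with uniform
bounds `|u_k|, |∇u_k|²_g, |∇²u_k|²_g ≤ C` has a subsequence `u_{φ(k)}` converging pointwise,
together with its background operators (at `s_{φ(k)}`, to the one of the limit at `t`) and its
background scalars, to a `C^∞` function `v`. In the source this is exactly what "the `C²` estimate
implies uniform ellipticity, and the `C^{2,α}` estimate then follows from the work of [Krylov] and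
[Evans]" (Prop. 6) plus Arzelà–Ascoli and "classical elliptic regularity theory" (§5) deliver;
given it, the fact is `solvable_of_background_limit` applied to the solutions
(`IsPathSolution.backgroundPathOperator_eq`, `IsPathSolution.backgroundScalar_pos`) provided by the
hypothesis of the fact. [cite: GurskyViaclovsky2003, Prop. 6 and §5 (proof of Thm. 1)] -/
theorem pathClosed_of_backgroundCompactness
    (hcore : ∀ (M : Type) [TopologicalSpace M] [T2Space M] [SecondCountableTopology M]
      [ChartedSpace (EuclideanSpace ℝ (Fin 4)) M] [IsManifold (𝓡 4) ∞ M]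
      [CompactSpace M] [ConnectedSpace M]
      (g : PseudoRiemannianMetric (𝓡 4) ∞ (EuclideanSpace ℝ (Fin 4))
        (TangentSpace (𝓡 4) : M → Type _))
      [g.HasLeviCivita], g.IsRiemannian →
      ∀ (q : M → ℝ) (C : ℝ), ContMDiff (𝓡 4) 𝓘(ℝ) ∞ q → (∀ x, 0 < q x) →
      ∀ (s : ℕ → ℝ) (t : ℝ), Tendsto s atTop (𝓝 t) → (∀ k, s k ≤ 1) →
      ∀ (u : ℕ → M → ℝ), (∀ k, ContMDiff (𝓡 4) 𝓘(ℝ) ∞ (u k)) →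
        (∀ k x, backgroundPathOperator g (s k) (fun y ↦ -u k y) x =
          q x * Real.exp (-4 * (-u k x))) →
        (∀ k x, 0 < backgroundScalar g (fun y ↦ -u k y) x) →
        (∀ k x, |u k x| ≤ C ∧ g.gradSq (u k) x ≤ C ∧ g.normSq x (g.hessian (u k) x) ≤ C) →
        ∃ (v : M → ℝ) (φ : ℕ → ℕ), StrictMono φ ∧ ContMDiff (𝓡 4) 𝓘(ℝ) ∞ v ∧
          (∀ x, Tendsto (fun k ↦ u (φ k) x) atTop (𝓝 (v x))) ∧
          (∀ x, Tendsto (fun k ↦ backgroundPathOperator g (s (φ k)) (fun y ↦ -u (φ k) y) x)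
            atTop (𝓝 (backgroundPathOperator g t (fun y ↦ -v y) x))) ∧
          (∀ x, Tendsto (fun k ↦ backgroundScalar g (fun y ↦ -u (φ k) y) x) atTop
            (𝓝 (backgroundScalar g (fun y ↦ -v y) x)))) :
    gurskyViaclovsky_pathClosed_weighted_four := by
  intro M _ _ _ _ _ _ _ g _ hg q C hq hq0 s t hs hs1 hsol
  choose hk hLC u hu using hsol
  obtain ⟨v, φ, -, hv, hlimu, hlimP, hlimS⟩ :=
    hcore M g hg q C hq hq0 s t hs hs1 u (fun k ↦ (hu k).1.contMDiff)
      (fun k x ↦ (hu k).1.backgroundPathOperator_eq x)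
      (fun k x ↦ (hu k).1.backgroundScalar_pos x) (fun k x ↦ (hu k).2 x)
  refine solvable_of_background_limit g hg hq0 (s := fun k ↦ s (φ k))
    (wk := fun k y ↦ -u (φ k) y) (w := fun y ↦ -v y) hv.neg
    (fun k x ↦ (hu (φ k)).1.backgroundPathOperator_eq x)
    (fun k x ↦ (hu (φ k)).1.backgroundScalar_pos x) (fun x ↦ (hlimu x).neg) hlimP hlimS

/-- **`gurskyViaclovsky_pathClosed_weighted_four` follows from `C²`-compactness with a smooth
limit, frame form** — the same reduction with the compactness principle `hcore` stated through
`C²` convergence proper: a subsequence `u_{φ(k)} → v ∈ C^∞` pointwise together with the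
orthonormal-frame entries of the covariant Hessians `Hess_g u_{φ(k)}(e_a,e_b) → Hess_g v(e_a,e_b)`
and of the differentials `du_{φ(k)}(e_a) → dv(e_a)` at every point (what Evans–Krylov `C^{2,α}`
bounds + Arzelà–Ascoli + Schauder regularity produce; NOT proved in the tree). The background
operators and scalars then converge by `tendsto_backgroundPathOperator_of_frame`,
`tendsto_backgroundScalar_of_frame`, and `solvable_of_frame_limit` closes.
[cite: GurskyViaclovsky2003, Prop. 6 and §5 (proof of Thm. 1)] -/
theorem pathClosed_of_frameCompactness
    (hcore : ∀ (M : Type) [TopologicalSpace M] [T2Space M] [SecondCountableTopology M]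
      [ChartedSpace (EuclideanSpace ℝ (Fin 4)) M] [IsManifold (𝓡 4) ∞ M]
      [CompactSpace M] [ConnectedSpace M]
      (g : PseudoRiemannianMetric (𝓡 4) ∞ (EuclideanSpace ℝ (Fin 4))
        (TangentSpace (𝓡 4) : M → Type _))
      [g.HasLeviCivita], g.IsRiemannian →
      ∀ (q : M → ℝ) (C : ℝ), ContMDiff (𝓡 4) 𝓘(ℝ) ∞ q → (∀ x, 0 < q x) →
      ∀ (s : ℕ → ℝ) (t : ℝ), Tendsto s atTop (𝓝 t) → (∀ k, s k ≤ 1) →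
      ∀ (u : ℕ → M → ℝ), (∀ k, ContMDiff (𝓡 4) 𝓘(ℝ) ∞ (u k)) →
        (∀ k x, backgroundPathOperator g (s k) (fun y ↦ -u k y) x =
          q x * Real.exp (-4 * (-u k x))) →
        (∀ k x, 0 < backgroundScalar g (fun y ↦ -u k y) x) →
        (∀ k x, |u k x| ≤ C ∧ g.gradSq (u k) x ≤ C ∧ g.normSq x (g.hessian (u k) x) ≤ C) →
        ∃ (v : M → ℝ) (φ : ℕ → ℕ), StrictMono φ ∧ ContMDiff (𝓡 4) 𝓘(ℝ) ∞ v ∧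
          (∀ x, Tendsto (fun k ↦ u (φ k) x) atTop (𝓝 (v x))) ∧
          ∀ (x : M) (e : Fin 4 → TangentSpace (𝓡 4) x), g.IsOrthonormalFrame x e →
            (∀ a b, Tendsto (fun k ↦ g.hessian (u (φ k)) x (e a) (e b)) atTop
              (𝓝 (g.hessian v x (e a) (e b)))) ∧
            (∀ a, Tendsto (fun k ↦ mvfderiv (𝓡 4) (u (φ k)) x (e a)) atTop
              (𝓝 (mvfderiv (𝓡 4) v x (e a))))) :
    gurskyViaclovsky_pathClosed_weighted_four := by
  intro M _ _ _ _ _ _ _ g _ hg q C hq hq0 s t hs hs1 hsol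
  choose hk hLC u hu using hsol
  obtain ⟨v, φ, hφ, hv, hlimu, hjet⟩ :=
    hcore M g hg q C hq hq0 s t hs hs1 u (fun k ↦ (hu k).1.contMDiff)
      (fun k x ↦ (hu k).1.backgroundPathOperator_eq x)
      (fun k x ↦ (hu k).1.backgroundScalar_pos x) (fun k x ↦ (hu k).2 x)
  have hH : ∀ (f : M → ℝ) (x : M) (e : Fin 4 → TangentSpace (𝓡 4) x) (a b : Fin 4),
      g.hessian (fun y ↦ -f y) x (e a) (e b) = -g.hessian f x (e a) (e b) := fun f x e a b ↦ by
    change g.hessian (-f) x (e a) (e b) = _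
    rw [g.hessian_neg f x]
    rfl
  have hd : ∀ (f : M → ℝ) (x : M) (e : Fin 4 → TangentSpace (𝓡 4) x) (a : Fin 4),
      mvfderiv (𝓡 4) (fun y ↦ -f y) x (e a) = -mvfderiv (𝓡 4) f x (e a) := fun f x e a ↦ by
    change mvfderiv (𝓡 4) (-f) x (e a) = _
    rw [mvfderiv_neg]
    rfl
  refine solvable_of_frame_limit g hg hq0 (hs.comp hφ.tendsto_atTop)
    (wk := fun k y ↦ -u (φ k) y) (w := fun y ↦ -v y) (fun k ↦ (hu (φ k)).1.contMDiff.neg) hv.neg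
    (fun k x ↦ (hu (φ k)).1.backgroundPathOperator_eq x)
    (fun k x ↦ (hu (φ k)).1.backgroundScalar_pos x) (fun x ↦ (hlimu x).neg) fun x e he ↦ ⟨?_, ?_⟩
  · intro a b
    simp only [hH]
    exact ((hjet x e he).1 a b).neg
  · intro a
    simp only [hd]
    exact ((hjet x e he).2 a).neg

end Reduction

/-! ### From chart `C²` convergence to the frame hypotheses (appended) -/

section ChartTransport

open Literature.Geometry.Lorentzian

variable {M : Type*} [TopologicalSpace M] [ChartedSpace (EuclideanSpace ℝ (Fin 4)) M]
  [IsManifold (𝓡 4) ∞ M]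
  (g : PseudoRiemannianMetric (𝓡 4) ∞ (EuclideanSpace ℝ (Fin 4)) (TangentSpace (𝓡 4) : M → Type _))
  [g.HasLeviCivita]

/-- **Chart `C²` convergence at a point gives convergence of the covariant Hessians and of the
differentials at that point.** Let `u_k, v ∈ C^∞(M)` and `x ∈ M`; read the functions through the
inverse of the preferred chart at `x`, `U_k = u_k ∘ (chartAt x)⁻¹`, `V = v ∘ (chartAt x)⁻¹` (maps
on the model space `ℝ⁴`). If the first and second Fréchet derivatives of `U_k` at the point
`chartAt x x` converge to those of `V`, then `Hess_g u_k(x)(Y,Z) → Hess_g v(x)(Y,Z)` and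
`du_k(x)(Y) → dv(x)(Y)` for all tangent vectors `Y, Z` — in the chart the covariant Hessian is
`H_{ij} = ∂_i∂_jU − Γ^k_{ij}∂_kU` (O'Neill 1983, Lemma 3.49; tree: `OpensChart.hessian_eq` on the
metric pulled back along the inverse chart, `hessian_comap_apply`, `mvfderiv_comp_apply`), a
continuous function of the `2`-jet with the Christoffel symbols of `g` at `x` fixed. This turns
`C²_loc` convergence in charts (the output of Evans–Krylov + Arzelà–Ascoli) into the frame
hypotheses of `solvable_of_frame_limit` / `pathClosed_of_frameCompactness`.
[cite: ONeill1983, Ch. 3, Lemma 3.49] -/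
theorem tendsto_hessian_and_mvfderiv_of_chart {uk : ℕ → M → ℝ} {v : M → ℝ}
    (huk : ∀ k, ContMDiff (𝓡 4) 𝓘(ℝ) ∞ (uk k)) (hv : ContMDiff (𝓡 4) 𝓘(ℝ) ∞ v) (x : M)
    (hD1 : Tendsto
      (fun k ↦ fderiv ℝ (fun y ↦ uk k ((chartAt (EuclideanSpace ℝ (Fin 4)) x).symm y))
        (chartAt (EuclideanSpace ℝ (Fin 4)) x x)) atTop
      (𝓝 (fderiv ℝ (fun y ↦ v ((chartAt (EuclideanSpace ℝ (Fin 4)) x).symm y))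
        (chartAt (EuclideanSpace ℝ (Fin 4)) x x))))
    (hD2 : Tendsto
      (fun k ↦ fderiv ℝ (fderiv ℝ (fun y ↦ uk k ((chartAt (EuclideanSpace ℝ (Fin 4)) x).symm y)))
        (chartAt (EuclideanSpace ℝ (Fin 4)) x x)) atTop
      (𝓝 (fderiv ℝ (fderiv ℝ (fun y ↦ v ((chartAt (EuclideanSpace ℝ (Fin 4)) x).symm y)))
        (chartAt (EuclideanSpace ℝ (Fin 4)) x x)))) :
    (∀ Y Z : TangentSpace (𝓡 4) x,
        Tendsto (fun k ↦ g.hessian (uk k) x Y Z) atTop (𝓝 (g.hessian v x Y Z))) ∧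
      ∀ Y : TangentSpace (𝓡 4) x,
        Tendsto (fun k ↦ mvfderiv (𝓡 4) (uk k) x Y) atTop (𝓝 (mvfderiv (𝓡 4) v x Y)) := by
  -- the inverse chart at `x` (as in `ricci_conformal_exp`)
  set U : TopologicalSpace.Opens (EuclideanSpace ℝ (Fin 4)) :=
    ⟨(chartAt (EuclideanSpace ℝ (Fin 4)) x).target,
      (chartAt (EuclideanSpace ℝ (Fin 4)) x).open_target⟩ with hU
  set Φ : U → M := fun u ↦ (chartAt (EuclideanSpace ℝ (Fin 4)) x).symm u with hΦdef
  have hΦ : ContMDiff 𝓘(ℝ, EuclideanSpace ℝ (Fin 4)) 𝓘(ℝ, EuclideanSpace ℝ (Fin 4)) (∞ + 1) Φ :=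
    ChartInverseSelf.contMDiff_symm x
  have hΦ' : ∀ u, Function.Injective
      (mfderiv 𝓘(ℝ, EuclideanSpace ℝ (Fin 4)) 𝓘(ℝ, EuclideanSpace ℝ (Fin 4)) Φ u) :=
    ChartInverseSelf.injective_mfderiv_symm x
  have hdim : Module.finrank ℝ (EuclideanSpace ℝ (Fin 4)) =
      Module.finrank ℝ (EuclideanSpace ℝ (Fin 4)) := rfl
  have hpb : contMDiff_pullbackBilin 𝓘(ℝ, EuclideanSpace ℝ (Fin 4)) M
      𝓘(ℝ, EuclideanSpace ℝ (Fin 4)) U ∞ := contMDiff_pullbackBilin_holds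
  set u₀ : U := ⟨chartAt (EuclideanSpace ℝ (Fin 4)) x x,
    (chartAt (EuclideanSpace ℝ (Fin 4)) x).map_source (mem_chart_source _ x)⟩ with hu₀
  have hx : Φ u₀ = x := (chartAt (EuclideanSpace ℝ (Fin 4)) x).left_inv (mem_chart_source _ x)
  -- the pulled-back metric and its representative
  set gU := g.comap hpb Φ hΦ hΦ' hdim with hgU
  haveI : gU.HasLeviCivita := gU.hasLeviCivita
  set G : EuclideanSpace ℝ (Fin 4) →
      EuclideanSpace ℝ (Fin 4) →L[ℝ] EuclideanSpace ℝ (Fin 4) →L[ℝ] ℝ :=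
    Function.extend (Subtype.val : U → EuclideanSpace ℝ (Fin 4))
      (fun y : U ↦ (gU.val y :
        EuclideanSpace ℝ (Fin 4) →L[ℝ] EuclideanSpace ℝ (Fin 4) →L[ℝ] ℝ)) (fun _ ↦ 0) with hGdef
  have hG : ∀ y : U, gU.val y = G y := fun y ↦ by
    rw [hGdef, Subtype.val_injective.extend_apply]
  have hGx : DifferentiableAt ℝ G u₀ := OpensChart.differentiableAt_repr hG u₀
  -- the chart representatives are `C²` at `u₀`
  have h2top : (2 : WithTop ℕ∞) ≤ ∞ := WithTop.coe_le_coe.mpr le_top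
  have hUk2 : ∀ k, ContDiffAt ℝ 2
      (fun y ↦ uk k ((chartAt (EuclideanSpace ℝ (Fin 4)) x).symm y)) u₀ := fun k ↦
    (ChartInverseSelf.contDiffAt_comp_symm x (huk k) u₀.2).of_le h2top
  have hV2 : ContDiffAt ℝ 2 (fun y ↦ v ((chartAt (EuclideanSpace ℝ (Fin 4)) x).symm y)) u₀ :=
    (ChartInverseSelf.contDiffAt_comp_symm x hv u₀.2).of_le h2top
  have hUkrep : ∀ k (y : U), (uk k ∘ Φ) y =
      (fun y ↦ uk k ((chartAt (EuclideanSpace ℝ (Fin 4)) x).symm y)) y := fun k y ↦ rfl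
  have hVrep : ∀ y : U, (v ∘ Φ) y =
      (fun y ↦ v ((chartAt (EuclideanSpace ℝ (Fin 4)) x).symm y)) y := fun y ↦ rfl
  -- chart Hessians (O'Neill 3.49) and their convergence on chart vectors
  have hHk : ∀ k, gU.hessian (uk k ∘ Φ) u₀ =
      OpensChart.hessianForm gU G (fun y ↦ uk k ((chartAt (EuclideanSpace ℝ (Fin 4)) x).symm y))
        u₀ := fun k ↦ OpensChart.hessian_eq hG u₀ hGx (hUkrep k) (hUk2 k)
  have hHv : gU.hessian (v ∘ Φ) u₀ =
      OpensChart.hessianForm gU G (fun y ↦ v ((chartAt (EuclideanSpace ℝ (Fin 4)) x).symm y))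
        u₀ := OpensChart.hessian_eq hG u₀ hGx hVrep hV2
  have keyH : ∀ Y' Z' : TangentSpace 𝓘(ℝ, EuclideanSpace ℝ (Fin 4)) u₀,
      Tendsto (fun k ↦ gU.hessian (uk k ∘ Φ) u₀ Y' Z') atTop
        (𝓝 (gU.hessian (v ∘ Φ) u₀ Y' Z')) := by
    intro Y' Z'
    simp only [hHk, hHv]
    refine Tendsto.sub ?_ ?_
    · exact (((continuous_eval_const Z').comp (continuous_eval_const Y')).tendsto _).comp hD2
    · exact ((continuous_eval_const
        (OpensChart.christoffel gU G u₀ Z' Y')).tendsto _).comp hD1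
  -- smoothness data at `Φ u₀`
  have h2 : (2 : ℕ∞ω) ≤ ∞ := WithTop.coe_le_coe.mpr le_top
  have hk2 : ∀ k, ContMDiffAt (𝓡 4) 𝓘(ℝ) 2 (uk k) (Φ u₀) := fun k ↦ ((huk k).of_le h2) _
  have hv2' : ContMDiffAt (𝓡 4) 𝓘(ℝ) 2 v (Φ u₀) := (hv.of_le h2) _
  have hkd : ∀ k, MDifferentiableAt (𝓡 4) 𝓘(ℝ, ℝ) (uk k) (Φ u₀) := fun k ↦
    (hk2 k).mdifferentiableAt (by simp)
  have hvd : MDifferentiableAt (𝓡 4) 𝓘(ℝ, ℝ) v (Φ u₀) := hv2'.mdifferentiableAt (by simp)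
  have hΦd : MDifferentiableAt 𝓘(ℝ, EuclideanSpace ℝ (Fin 4)) 𝓘(ℝ, EuclideanSpace ℝ (Fin 4))
      Φ u₀ := ((hΦ.of_le le_self_add) u₀).mdifferentiableAt (by simp)
  set e := mfderivEquivOfInjective (I := 𝓘(ℝ, EuclideanSpace ℝ (Fin 4)))
    (I' := 𝓘(ℝ, EuclideanSpace ℝ (Fin 4))) Φ u₀ (hΦ' u₀) hdim with he
  -- move the base point to `Φ u₀`
  rw [← hx]
  refine ⟨fun Y Z ↦ ?_, fun Y ↦ ?_⟩
  · obtain ⟨Y', rfl⟩ : ∃ Y', mfderiv 𝓘(ℝ, EuclideanSpace ℝ (Fin 4))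
        𝓘(ℝ, EuclideanSpace ℝ (Fin 4)) Φ u₀ Y' = Y :=
      ⟨e.symm Y, mfderiv_mfderivEquivOfInjective_symm _ _ _ _ Y⟩
    obtain ⟨Z', rfl⟩ : ∃ Z', mfderiv 𝓘(ℝ, EuclideanSpace ℝ (Fin 4))
        𝓘(ℝ, EuclideanSpace ℝ (Fin 4)) Φ u₀ Z' = Z :=
      ⟨e.symm Z, mfderiv_mfderivEquivOfInjective_symm _ _ _ _ Z⟩
    have e1 : ∀ k, g.hessian (uk k) (Φ u₀)
        (mfderiv 𝓘(ℝ, EuclideanSpace ℝ (Fin 4)) 𝓘(ℝ, EuclideanSpace ℝ (Fin 4)) Φ u₀ Y')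
        (mfderiv 𝓘(ℝ, EuclideanSpace ℝ (Fin 4)) 𝓘(ℝ, EuclideanSpace ℝ (Fin 4)) Φ u₀ Z') =
        gU.hessian (uk k ∘ Φ) u₀ Y' Z' := fun k ↦
      (g.hessian_comap_apply hpb hΦ hΦ' hdim (hk2 k) Y' Z').symm
    have e2 : g.hessian v (Φ u₀)
        (mfderiv 𝓘(ℝ, EuclideanSpace ℝ (Fin 4)) 𝓘(ℝ, EuclideanSpace ℝ (Fin 4)) Φ u₀ Y')
        (mfderiv 𝓘(ℝ, EuclideanSpace ℝ (Fin 4)) 𝓘(ℝ, EuclideanSpace ℝ (Fin 4)) Φ u₀ Z') =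
        gU.hessian (v ∘ Φ) u₀ Y' Z' :=
      (g.hessian_comap_apply hpb hΦ hΦ' hdim hv2' Y' Z').symm
    rw [e2]
    exact (keyH Y' Z').congr fun k ↦ (e1 k).symm
  · obtain ⟨Y', rfl⟩ : ∃ Y', mfderiv 𝓘(ℝ, EuclideanSpace ℝ (Fin 4))
        𝓘(ℝ, EuclideanSpace ℝ (Fin 4)) Φ u₀ Y' = Y :=
      ⟨e.symm Y, mfderiv_mfderivEquivOfInjective_symm _ _ _ _ Y⟩
    have e1 : ∀ k, mvfderiv (𝓡 4) (uk k) (Φ u₀)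
        (mfderiv 𝓘(ℝ, EuclideanSpace ℝ (Fin 4)) 𝓘(ℝ, EuclideanSpace ℝ (Fin 4)) Φ u₀ Y') =
        fderiv ℝ (fun y ↦ uk k ((chartAt (EuclideanSpace ℝ (Fin 4)) x).symm y)) u₀ Y' := by
      intro k
      rw [← mvfderiv_comp_apply (hkd k) hΦd,
        OpensChart.mvfderiv_eq u₀ (uk k ∘ Φ) _ (hUkrep k) ((hUk2 k).differentiableAt (by norm_num))]
    have e2 : mvfderiv (𝓡 4) v (Φ u₀)
        (mfderiv 𝓘(ℝ, EuclideanSpace ℝ (Fin 4)) 𝓘(ℝ, EuclideanSpace ℝ (Fin 4)) Φ u₀ Y') =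
        fderiv ℝ (fun y ↦ v ((chartAt (EuclideanSpace ℝ (Fin 4)) x).symm y)) u₀ Y' := by
      rw [← mvfderiv_comp_apply hvd hΦd,
        OpensChart.mvfderiv_eq u₀ (v ∘ Φ) _ hVrep (hV2.differentiableAt (by norm_num))]
    rw [e2]
    refine Tendsto.congr (fun k ↦ (e1 k).symm) ?_
    exact ((continuous_eval_const Y').tendsto _).comp hD1

/-- **`gurskyViaclovsky_pathClosed_weighted_four` follows from `C²`-compactness with a smooth
limit, chart form** — the compactness principle stated through the CHART representatives:
a subsequence `u_{φ(k)}` and `v ∈ C^∞(M)` with `u_{φ(k)}(x) → v(x)` and, at every point `x`, the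
first and second Fréchet derivatives of `u_{φ(k)} ∘ (chartAt x)⁻¹` at `chartAt x x` converging to
those of `v ∘ (chartAt x)⁻¹` (a consequence of `C²_loc` convergence in the charts, which is what
Evans–Krylov `C^{2,α}` bounds + Arzelà–Ascoli + Schauder regularity produce; NOT proved in the
tree). By `tendsto_hessian_and_mvfderiv_of_chart` this gives the frame hypotheses of
`pathClosed_of_frameCompactness`' principle, and the fact follows as there.
[cite: GurskyViaclovsky2003, Prop. 6 and §5 (proof of Thm. 1)] -/
theorem pathClosed_of_chartCompactness
    (hcore : ∀ (M : Type) [TopologicalSpace M] [T2Space M] [SecondCountableTopology M]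
      [ChartedSpace (EuclideanSpace ℝ (Fin 4)) M] [IsManifold (𝓡 4) ∞ M]
      [CompactSpace M] [ConnectedSpace M]
      (g : PseudoRiemannianMetric (𝓡 4) ∞ (EuclideanSpace ℝ (Fin 4))
        (TangentSpace (𝓡 4) : M → Type _))
      [g.HasLeviCivita], g.IsRiemannian →
      ∀ (q : M → ℝ) (C : ℝ), ContMDiff (𝓡 4) 𝓘(ℝ) ∞ q → (∀ x, 0 < q x) →
      ∀ (s : ℕ → ℝ) (t : ℝ), Tendsto s atTop (𝓝 t) → (∀ k, s k ≤ 1) →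
      ∀ (u : ℕ → M → ℝ), (∀ k, ContMDiff (𝓡 4) 𝓘(ℝ) ∞ (u k)) →
        (∀ k x, backgroundPathOperator g (s k) (fun y ↦ -u k y) x =
          q x * Real.exp (-4 * (-u k x))) →
        (∀ k x, 0 < backgroundScalar g (fun y ↦ -u k y) x) →
        (∀ k x, |u k x| ≤ C ∧ g.gradSq (u k) x ≤ C ∧ g.normSq x (g.hessian (u k) x) ≤ C) →
        ∃ (v : M → ℝ) (φ : ℕ → ℕ), StrictMono φ ∧ ContMDiff (𝓡 4) 𝓘(ℝ) ∞ v ∧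
          (∀ x, Tendsto (fun k ↦ u (φ k) x) atTop (𝓝 (v x))) ∧
          ∀ x : M,
            Tendsto (fun k ↦ fderiv ℝ
                (fun y ↦ u (φ k) ((chartAt (EuclideanSpace ℝ (Fin 4)) x).symm y))
                (chartAt (EuclideanSpace ℝ (Fin 4)) x x)) atTop
              (𝓝 (fderiv ℝ (fun y ↦ v ((chartAt (EuclideanSpace ℝ (Fin 4)) x).symm y))
                (chartAt (EuclideanSpace ℝ (Fin 4)) x x))) ∧
            Tendsto (fun k ↦ fderiv ℝ (fderiv ℝ
                (fun y ↦ u (φ k) ((chartAt (EuclideanSpace ℝ (Fin 4)) x).symm y)))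
                (chartAt (EuclideanSpace ℝ (Fin 4)) x x)) atTop
              (𝓝 (fderiv ℝ (fderiv ℝ (fun y ↦ v ((chartAt (EuclideanSpace ℝ (Fin 4)) x).symm y)))
                (chartAt (EuclideanSpace ℝ (Fin 4)) x x)))) :
    gurskyViaclovsky_pathClosed_weighted_four := by
  refine pathClosed_of_frameCompactness fun M _ _ _ _ _ _ _ g _ hg q C hq hq0 s t hs hs1 u hu heq
    hpos hbd ↦ ?_
  obtain ⟨v, φ, hφ, hv, hlim, hchart⟩ := hcore M g hg q C hq hq0 s t hs hs1 u hu heq hpos hbd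
  refine ⟨v, φ, hφ, hv, hlim, fun x e _ ↦ ?_⟩
  have key := tendsto_hessian_and_mvfderiv_of_chart g (uk := fun k ↦ u (φ k)) (fun k ↦ hu (φ k))
    hv x (hchart x).1 (hchart x).2
  exact ⟨fun a b ↦ key.1 (e a) (e b), fun a ↦ key.2 (e a)⟩

end ChartTransport

end Literature.Geometry.Riemannian.GurskyViaclovskyPath

end
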